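import Literature.NumberTheory.PositionalNumberSystems.MaximumPeriodDecimals
import HarnessLib

/-!
# Route `ResidualThetaTransportAtTwo`, node (G′)_N (item 27436; cruxes Kan⁺ 20688 / Kμ⁺ 20689 / 21437): ARITHMETIC TOOLS for the
# reduction of the node to Artin's primitive-root conjecture for the base 2 in progressions `≡ 3 (mod 8)`

Cell `bsd-wall`, extra width seat `bsd-wall-rtt-p3-w5` g0 (2026-08-28). THEOREMS ONLY (pure Mathlib number theory; no `def`, no `sorry`);
helper `--supports stmt-BirchSwinnertonDyer-20688`; BSD is not proved by this. Used by the sequel `…CuspSpanArtinReduction`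
(`ArtinRoute.witnesses_of_artin`: (AP₃) ⟹ the divisor witnesses of `…CuspSpanArtinWitness` at every odd level).

* `ArtinRoute.exists_isCoprime_add_mul` — coprime shift: `gcd(a, u) = 1`, `m ≠ 0` ⟹ some `a + ju` is prime to `m`
  (`j` = product of the primes of `m` not dividing `a`).
* `ArtinRoute.jacobiSym_eq_one_of_progression` — for odd naturals `A ≡ q ≡ 3 (mod 4)`, `gcd(c, A) = 1`, `s = ±1` and
  `q ≡ −s·(c/A)·c (mod A)`: `J(sA | q) = 1` (reciprocity in the `3 (mod 4)` case). This is the sign bookkeeping that removes the quadratic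
  obstruction of `Cruxes/ThetaLayerLambdaCongruenceAtTwo/Lines/birth-generation.md` §4.2 (ii).
* `ArtinRoute.exists_pow_four_eq_of_isSquare`, `ArtinRoute.four_pow_half_eq_one` — in `ZMod q` with `2` generating the non-zero residues,
  a non-zero square is a power of `4`; `4^{(q−1)/2} = 1` (Fermat).
* `ArtinRoute.exists_two_pow_eq_of_orderOf` — `orderOf (2 : ZMod q) = q − 1` ⟹ every non-zero residue is a power of `2`
  (Hardy–Wright Thm. 139, the tree's `MaximumPeriodDecimals.exists_pow_mod_eq`).

References: G. H. Hardy, E. M. Wright, *An Introduction to the Theory of Numbers* (6th ed. 2008) §5.5, §6.1, §6.11–6.13, §9.6 [HardyWright2008].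
-/

set_option autoImplicit false
set_option linter.dupNamespace false

noncomputable section

open scoped BigOperators NumberTheorySymbols

namespace Summit.BirchSwinnertonDyer.BirchSwinnertonDyer.Theorems.SignedMuAtTwo.ArtinRoute

/-- **Coprime shift.** If `gcd(a, u) = 1` then some translate `a + j·u` is prime to any given `m ≠ 0`: take `j` = the product of the
primes dividing `m` but not `a`. [cite: HardyWright2008, §5.5 (Thm. 57, the same CRT argument)] -/
theorem exists_isCoprime_add_mul {a u : ℤ} (h : IsCoprime a u) (m : ℕ) (hm : m ≠ 0) :
    ∃ j : ℤ, IsCoprime (a + j * u) (m : ℤ) := by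
  classical
  let S : Finset ℕ := m.primeFactors.filter (fun p ↦ ¬ ((p : ℤ) ∣ a))
  let P : ℕ := ∏ p ∈ S, p
  refine ⟨(P : ℤ), ?_⟩
  rw [Int.isCoprime_iff_gcd_eq_one, Int.gcd_eq_natAbs, Int.natAbs_natCast]
  refine Nat.Coprime.symm (Nat.coprime_of_dvd fun p hp hpm hpa ↦ ?_)
  have hpa' : (p : ℤ) ∣ a + P * u := Int.natCast_dvd.mpr hpa
  by_cases hdiv : (p : ℤ) ∣ a
  · -- then `p ∤ u` and `p ∤ P`
    have hpu : ¬ (p : ℤ) ∣ u := by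
      intro hu
      have hunit := h.isUnit_of_dvd' hdiv hu
      rw [Int.isUnit_iff_natAbs_eq, Int.natAbs_natCast] at hunit
      exact hp.one_lt.ne' hunit
    have hpP : ¬ (p : ℤ) ∣ (P : ℤ) := by
      intro hP
      have hP' : p ∣ P := Int.natCast_dvd_natCast.mp hP
      obtain ⟨r, hrS, hpr⟩ := (Nat.Prime.prime hp).dvd_finsetProd_iff _ |>.mp hP'
      have hr : r.Prime := Nat.prime_of_mem_primeFactors (Finset.mem_filter.mp hrS).1
      have hpr' : p = r := (Nat.prime_dvd_prime_iff_eq hp hr).mp hpr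
      exact (Finset.mem_filter.mp hrS).2 (hpr' ▸ hdiv)
    have hPu : (p : ℤ) ∣ (P : ℤ) * u := by
      have := dvd_sub hpa' hdiv
      rwa [add_sub_cancel_left] at this
    rcases Int.Prime.dvd_mul' hp hPu with h1 | h1
    · exact hpP h1
    · exact hpu h1
  · -- then `p ∣ P`
    have hpS : p ∈ S := Finset.mem_filter.mpr ⟨Nat.mem_primeFactors.mpr ⟨hp, hpm, hm⟩, hdiv⟩
    have hpP : (p : ℤ) ∣ (P : ℤ) := Int.natCast_dvd_natCast.mpr (Finset.dvd_prod_of_mem _ hpS)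
    have : (p : ℤ) ∣ a := by
      have := dvd_sub hpa' (dvd_mul_of_dvd_left hpP u)
      rwa [add_sub_cancel_right] at this
    exact hdiv this

/-- **Jacobi bookkeeping for the Artin prime.** For odd naturals `A ≡ q ≡ 3 (mod 4)`, an integer `c` prime to `A`, a sign `s = ±1`
and `q ≡ −s·(c/A)·c (mod A)`: `J(s·A | q) = 1` (quadratic reciprocity in the `3 (mod 4)` case, `(−1/A) = (−1/q) = −1`).
[cite: HardyWright2008, §6.11–§6.13 (Thm. 98–99, reciprocity)] -/
theorem jacobiSym_eq_one_of_progression {A q : ℕ} (hA : A % 4 = 3) (hq : q % 4 = 3) {c s : ℤ}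
    (hs : s = 1 ∨ s = -1) (hc : c.gcd A = 1)
    (hmod : (q : ℤ) ≡ -s * jacobiSym c A * c [ZMOD A]) : J(s * A | q) = 1 := by
  have hAodd : Odd A := Nat.odd_iff.mpr (by omega)
  have hqodd : Odd q := Nat.odd_iff.mpr (by omega)
  have hJc : J(c | A) = 1 ∨ J(c | A) = -1 := jacobiSym.eq_one_or_neg_one hc
  have h1 : J((A : ℤ) | q) = -J((q : ℤ) | A) := jacobiSym.quadratic_reciprocity_three_mod_four hA hq
  have h2 : J((q : ℤ) | A) = J(-s * J(c | A) * c | A) := jacobiSym.mod_left' hmod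
  have hm1 : J(-1 | A) = -1 := by rw [jacobiSym.at_neg_one hAodd, ZMod.χ₄_nat_three_mod_four hA]
  have hm1q : J(-1 | q) = -1 := by rw [jacobiSym.at_neg_one hqodd, ZMod.χ₄_nat_three_mod_four hq]
  rw [jacobiSym.mul_left, jacobiSym.mul_left] at h2
  rw [jacobiSym.mul_left, h1, h2]
  rcases hs with rfl | rfl <;> rcases hJc with hJ | hJ <;>
    simp [hJ, hm1, hm1q, jacobiSym.one_left]

/-- In `ZMod q` with every non-zero residue a power of `2` (i.e. `2` a primitive root of the prime `q`), a non-zero SQUARE is a power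
of `4` (`y = 2^i ⟹ y² = 4^i`). [cite: HardyWright2008, §9.6 (Thm. 139, powers of a primitive root)] -/
theorem exists_pow_four_eq_of_isSquare {q : ℕ} [Fact q.Prime]
    (hgen : ∀ x : ZMod q, x ≠ 0 → ∃ i : ℕ, (2 : ZMod q) ^ i = x)
    {x : ZMod q} (hx : x ≠ 0) (hsq : IsSquare x) : ∃ i : ℕ, (4 : ZMod q) ^ i = x := by
  obtain ⟨y, rfl⟩ := hsq
  have hy : y ≠ 0 := fun h ↦ hx (by rw [h, mul_zero])
  obtain ⟨i, rfl⟩ := hgen y hy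
  refine ⟨i, ?_⟩
  rw [← mul_pow]; norm_num

/-- `4^{(q−1)/2} = 2^{q−1} = 1` in `ZMod q` for an odd prime `q` (Fermat). [cite: HardyWright2008, §6.1 (Thm. 71, Fermat)] -/
theorem four_pow_half_eq_one {q : ℕ} [Fact q.Prime] (hq : q % 2 = 1) :
    (4 : ZMod q) ^ ((q - 1) / 2) = 1 := by
  have h2 : (2 : ZMod q) ≠ 0 := by
    intro h
    have : q ∣ 2 := (ZMod.natCast_eq_zero_iff 2 q).mp (by exact_mod_cast h)
    have hle : q ≤ 2 := Nat.le_of_dvd (by norm_num) this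
    have hge : 2 ≤ q := (Fact.out : q.Prime).two_le
    omega
  have h := ZMod.pow_card_sub_one_eq_one h2
  have hq' : q - 1 = 2 * ((q - 1) / 2) := by omega
  rw [hq', pow_mul] at h
  rw [show (4 : ZMod q) = 2 ^ 2 by norm_num]
  exact h


/-- If `2` is a primitive root of the prime `q` (`orderOf (2 : ZMod q) = q − 1`), every non-zero residue is a power of `2`
(the tree's `MaximumPeriodDecimals.exists_pow_mod_eq`, Hardy–Wright Thm. 139, read in `ZMod q`). [cite: HardyWright2008, §9.6 (Thm. 139)] -/
theorem exists_two_pow_eq_of_orderOf {q : ℕ} (hq : q.Prime) (hroot : orderOf (2 : ZMod q) = q - 1)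
    (x : ZMod q) (hx : x ≠ 0) : ∃ i : ℕ, (2 : ZMod q) ^ i = x := by
  haveI := Fact.mk hq
  have h20 : (2 : ZMod q) ≠ 0 := by
    intro h0
    have hzero : orderOf (2 : ZMod q) = 0 := by
      rw [h0]
      refine orderOf_eq_zero_iff'.mpr fun n hn h1 ↦ ?_
      rw [zero_pow (by omega)] at h1
      exact zero_ne_one h1
    rw [hzero] at hroot
    have := hq.two_le
    omega
  have hcop : q.Coprime 2 := by
    rw [Nat.Prime.coprime_iff_not_dvd hq]
    intro hq2
    apply h20
    have h1 : ((2 : ℕ) : ZMod q) = 0 := (ZMod.natCast_eq_zero_iff 2 q).mpr hq2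
    rw [Nat.cast_ofNat] at h1
    exact h1
  have hv0 : 0 < x.val := Nat.pos_of_ne_zero fun h ↦ hx ((ZMod.val_eq_zero x).mp h)
  have hvq : x.val < q := ZMod.val_lt x
  have hroot' : orderOf ((2 : ℕ) : ZMod q) = q - 1 := by rw [Nat.cast_ofNat]; exact hroot
  obtain ⟨n, -, hn⟩ :=
    Literature.NumberTheory.PositionalNumberSystems.MaximumPeriodDecimals.exists_pow_mod_eq hq hcop hroot' hv0 hvq
  refine ⟨n, ?_⟩
  have h1 : (((2 ^ n % q : ℕ)) : ZMod q) = ((x.val : ℕ) : ZMod q) := by rw [hn]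
  rw [ZMod.natCast_mod, ZMod.natCast_zmod_val] at h1
  exact_mod_cast h1

end Summit.BirchSwinnertonDyer.BirchSwinnertonDyer.Theorems.SignedMuAtTwo.ArtinRoute

end
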